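import Literature.MathematicalPhysics.QuantumLattice.SpinChainsAkltBondProofs
import Literature.MathematicalPhysics.QuantumLattice.SpinChainsAkltCorrelationProofs
import HarnessLib

/-!
# The AKLT bond projection as an explicit rational table

Trunk **T-QLATTICE**. Sibling proof file of
`Literature/MathematicalPhysics/QuantumLattice/SpinChains.lean`, third step towards `aklt_gap_holds`:
the computational model behind the exact finite-size certificates. Everything here is exact
arithmetic over `ℚ`; the definitions are computable tables and matrices (no `Prop`-valued
definition, no named fact).

* `dTab a b c d = ⟨a b| 𝐒₀·𝐒₁ |c d⟩` and `pTab a b c d = ⟨a b| P₂ |c d⟩ ∈ ℚ`, the two-site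
  spin-`1` exchange operator and bond-spin-`2` projection in the product basis `|k₀ k₁⟩`,
  `k ↦ m = 1 - k` (`pTab` is a literal table; `pTab_eq` checks `P₂ = ⅙ D² + ½ D + ⅓` by `decide`).
* `bondMat n T i j`, the matrix on `n`-site configurations `Fin n → Fin 3` with two-site table `T`
  at the sites `(i, j)` and the identity elsewhere (`agreeOff`, a Boolean "equal off `{i, j}`");
  product and unit rules `bondMat_mul`, `bondMat_one`.
* The bridges to the operator vocabulary: `spinDot_two_apply` (entries of `𝐒_x·𝐒_y` for `x ≠ y`
  on any `Λ`), `spinDot_eq_map_bondMat` and **`akltProj_eq_map_bondMat`**: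
  `P₂(i, j) = (bondMat n pTab i j).map (ℚ → ℂ)` on `Op (Fin n) 3` for `i ≠ j`.
* Two structural facts about the table, by `decide`: `pTab` is symmetric (`pTab_symm`) and
  conserves the magnetisation `k₀ + k₁` (`pTab_mag`).

## Sources

I. Affleck, T. Kennedy, E. H. Lieb, H. Tasaki, Comm. Math. Phys. **115** (1988) 477–528, §2.1,
eq. (2.1) (`P₂ = ½ 𝐒_i·𝐒_{i+1} + ⅙ (𝐒_i·𝐒_{i+1})² + ⅓`); H. Tasaki, *Physics and Mathematics of
Quantum Many-Body Systems* (2020), §2.1 eqs. (2.1.5)–(2.1.6) (matrix elements of `S^±, Sᶻ`),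
§2.4 Problem 2.4.a (`𝐒₀·𝐒₁ = Sᶻ⊗Sᶻ + ½(S⁺⊗S⁻ + S⁻⊗S⁺)`), §7.1; S. Knabe, J. Stat. Phys. **52**
(1988) 627, §3 (exact diagonalisation of short AKLT chains in the `Sᶻ` product basis).
-/

namespace Literature.MathematicalPhysics.QuantumLattice

section Tables

/-! ### Two-site tables (computable, over `ℚ`) -/

/-- A two-site table `T a b c d = ⟨a b| T |c d⟩` of a two-site operator in the product basis of two
spins `1` (`k : Fin 3 ↦ m = 1 - k`). [folklore] -/
abbrev PairTab : Type := Fin 3 → Fin 3 → Fin 3 → Fin 3 → ℚ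

/-- The magnetic quantum number `m = 1 - k` of the local basis state `k : Fin 3`. [folklore] -/
def mQ (k : Fin 3) : ℚ := 1 - (k : ℚ)

/-- The table of the exchange operator of two spins `1`:
`⟨a b|𝐒₀·𝐒₁|c d⟩ = m_a m_b [c = a][d = b] + [c = a+1][d = b-1] + [c = a-1][d = b+1]`
(`Sᶻ⊗Sᶻ + ½(S⁺⊗S⁻ + S⁻⊗S⁺)` with `⟨k|S⁺|k+1⟩ = √2`). Tasaki (2020) §2.4, Problem 2.4.a. [folklore] -/
def dTab : PairTab := fun a b c d =>
  (if c = a ∧ d = b then mQ a * mQ b else 0) +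
  (if c.val = a.val + 1 ∧ d.val + 1 = b.val then 1 else 0) +
  (if c.val + 1 = a.val ∧ d.val = b.val + 1 then 1 else 0)

/-- The table of the identity, `⟨a b|𝟙|c d⟩ = [c = a][d = b]`. [folklore] -/
def deltaTab : PairTab := fun a b c d => if c = a ∧ d = b then 1 else 0

/-- Composition of two-site tables (the `9 × 9` matrix product). [folklore] -/
def tabMul (S T : PairTab) : PairTab := fun a b c d => ∑ e : Fin 3, ∑ f : Fin 3, S a b e f * T e f c d

/-- **The table of the bond-spin-`2` projection `P₂ = ⅙ (𝐒₀·𝐒₁)² + ½ 𝐒₀·𝐒₁ + ⅓`** of two spins `1`,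
as a literal (its `19` nonzero entries; checked against the polynomial in `pTab_eq`).
AKLT (1988), eq. (2.1); Knabe (1988) §3. [folklore] -/
def pTab (a b c d : Fin 3) : ℚ :=
  match a.val, b.val, c.val, d.val with
  | 0, 0, 0, 0 => 1
  | 0, 1, 0, 1 => mkRat 1 2
  | 0, 1, 1, 0 => mkRat 1 2
  | 0, 2, 0, 2 => mkRat 1 6
  | 0, 2, 1, 1 => mkRat 1 3
  | 0, 2, 2, 0 => mkRat 1 6
  | 1, 0, 0, 1 => mkRat 1 2
  | 1, 0, 1, 0 => mkRat 1 2
  | 1, 1, 0, 2 => mkRat 1 3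
  | 1, 1, 1, 1 => mkRat 2 3
  | 1, 1, 2, 0 => mkRat 1 3
  | 1, 2, 1, 2 => mkRat 1 2
  | 1, 2, 2, 1 => mkRat 1 2
  | 2, 0, 0, 2 => mkRat 1 6
  | 2, 0, 1, 1 => mkRat 1 3
  | 2, 0, 2, 0 => mkRat 1 6
  | 2, 1, 1, 2 => mkRat 1 2
  | 2, 1, 2, 1 => mkRat 1 2
  | 2, 2, 2, 2 => 1
  | _, _, _, _ => 0

/-- **`P₂ = ⅙ D² + ½ D + ⅓` entrywise** (`D = 𝐒₀·𝐒₁`), an identity of rational tables checked by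
evaluation. AKLT (1988), eq. (2.1). [folklore] -/
theorem pTab_eq (a b c d : Fin 3) :
    pTab a b c d = (1 / 6 : ℚ) * tabMul dTab dTab a b c d + (1 / 2 : ℚ) * dTab a b c d +
      (1 / 3 : ℚ) * deltaTab a b c d := by
  revert a b c d
  decide +kernel

/-- The projection table is symmetric: `⟨a b|P₂|c d⟩ = ⟨c d|P₂|a b⟩` (real symmetric matrix). [folklore] -/
theorem pTab_symm (a b c d : Fin 3) : pTab a b c d = pTab c d a b := by
  revert a b c d
  decide +kernel

/-- The projection table conserves the magnetisation: `⟨a b|P₂|c d⟩ ≠ 0 ⇒ a + b = c + d`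
(`P₂` commutes with `Sᶻ₀ + Sᶻ₁`). [folklore] -/
theorem pTab_mag (a b c d : Fin 3) (h : pTab a b c d ≠ 0) : a.val + b.val = c.val + d.val := by
  revert a b c d
  decide +kernel

/-! ### Bond matrices on `n`-site configurations -/

/-- Boolean test "`σ = τ` off the sites `i, j`". [folklore] -/
def agreeOff (n : ℕ) (i j : Fin n) (σ τ : Fin n → Fin 3) : Bool :=
  (List.finRange n).all fun k => decide (k = i) || decide (k = j) || decide (σ k = τ k)

/-- `agreeOff` says `σ k = τ k` for all `k ∉ {i, j}`. [folklore] -/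
theorem agreeOff_eq_true_iff {n : ℕ} (i j : Fin n) (σ τ : Fin n → Fin 3) :
    agreeOff n i j σ τ = true ↔ ∀ k, k ≠ i → k ≠ j → σ k = τ k := by
  simp only [agreeOff, List.all_eq_true, List.mem_finRange, true_implies, Bool.or_eq_true,
    decide_eq_true_eq]
  constructor
  · intro h k hki hkj
    exact (h k).elim (fun h' => h'.elim (fun h1 => absurd h1 hki) fun h1 => absurd h1 hkj) id
  · intro h k
    by_cases hki : k = i
    · exact Or.inl (Or.inl hki)
    · by_cases hkj : k = j
      · exact Or.inl (Or.inr hkj)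
      · exact Or.inr (h k hki hkj)

/-- **Bond matrix**: the two-site table `T` acting at the sites `(i, j)` of `n`-site configurations
and as the identity elsewhere, `⟨σ|bondMat|τ⟩ = [σ = τ off {i,j}] · T (σ i) (σ j) (τ i) (τ j)`
(the rational counterpart of `placePair`). [folklore] -/
def bondMat (n : ℕ) (T : PairTab) (i j : Fin n) : Matrix (Fin n → Fin 3) (Fin n → Fin 3) ℚ :=
  Matrix.of fun σ τ => if agreeOff n i j σ τ then T (σ i) (σ j) (τ i) (τ j) else 0

/-- Entries of a bond matrix (definitional unfolding). [folklore] -/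
theorem bondMat_apply {n : ℕ} (T : PairTab) (i j : Fin n) (σ τ : Fin n → Fin 3) :
    bondMat n T i j σ τ = if agreeOff n i j σ τ then T (σ i) (σ j) (τ i) (τ j) else 0 := rfl

/-- Bond matrices are additive in the table. [folklore] -/
theorem bondMat_add {n : ℕ} (S T : PairTab) (i j : Fin n) :
    bondMat n (S + T) i j = bondMat n S i j + bondMat n T i j := by
  ext σ τ
  simp only [bondMat_apply, Matrix.add_apply, Pi.add_apply]
  split_ifs <;> simp

/-- Bond matrices are homogeneous in the table. [folklore] -/
theorem bondMat_smul {n : ℕ} (c : ℚ) (T : PairTab) (i j : Fin n) :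
    bondMat n (c • T) i j = c • bondMat n T i j := by
  ext σ τ
  simp only [bondMat_apply, Matrix.smul_apply, Pi.smul_apply, smul_eq_mul]
  split_ifs <;> simp

/-- **The identity table gives the identity matrix.** [folklore] -/
theorem bondMat_one {n : ℕ} (i j : Fin n) : bondMat n deltaTab i j = 1 := by
  ext σ τ
  rw [bondMat_apply, Matrix.one_apply, deltaTab]
  by_cases hστ : σ = τ
  · subst hστ
    have h : agreeOff n i j σ σ = true := (agreeOff_eq_true_iff i j σ σ).2 fun _ _ _ => rfl
    simp [h]
  · rw [if_neg hστ]
    by_cases h : agreeOff n i j σ τ = true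
    · rw [if_pos h, if_neg]
      rintro ⟨hi, hj⟩
      apply hστ
      funext k
      by_cases hki : k = i
      · subst hki; exact hi.symm
      · by_cases hkj : k = j
        · subst hkj; exact hj.symm
        · exact (agreeOff_eq_true_iff i j σ τ).1 h k hki hkj
    · rw [if_neg h]

/-- **Product rule for bond matrices at the same bond** (`i ≠ j`): the tables compose,
`bondMat S · bondMat T = bondMat (S ∘ T)` (the intermediate configuration agrees with both off
`{i, j}`, so only its values at `i, j` are summed over). [folklore] -/
theorem bondMat_mul {n : ℕ} {i j : Fin n} (hij : i ≠ j) (S T : PairTab) :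
    bondMat n S i j * bondMat n T i j = bondMat n (tabMul S T) i j := by
  ext σ τ
  rw [Matrix.mul_apply, bondMat_apply]
  -- the configurations `σ[i ↦ e, j ↦ f]`
  set upd : Fin 3 × Fin 3 → (Fin n → Fin 3) :=
    fun ef => Function.update (Function.update σ i ef.1) j ef.2 with hupd
  have hupd_i : ∀ ef, upd ef i = ef.1 := fun ef => by
    simp only [hupd]; rw [Function.update_of_ne hij, Function.update_self]
  have hupd_j : ∀ ef, upd ef j = ef.2 := fun ef => by
    simp only [hupd]; rw [Function.update_self]
  have hupd_off : ∀ ef k, k ≠ i → k ≠ j → upd ef k = σ k := fun ef k hki hkj => by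
    simp only [hupd]; rw [Function.update_of_ne hkj, Function.update_of_ne hki]
  have hinj : Function.Injective upd := fun ef ef' h =>
    Prod.ext (by rw [← hupd_i ef, ← hupd_i ef', h]) (by rw [← hupd_j ef, ← hupd_j ef', h])
  have hagree : ∀ ρ, agreeOff n i j σ ρ = true → upd (ρ i, ρ j) = ρ := fun ρ h => by
    rw [agreeOff_eq_true_iff] at h
    funext k
    by_cases hkj : k = j
    · subst hkj; exact hupd_j _
    · by_cases hki : k = i
      · subst hki; exact hupd_i _
      · rw [hupd_off _ k hki hkj]; exact h k hki hkj
  -- restrict the sum over the intermediate configuration to the image of `upd`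
  have hzero : ∀ ρ, ρ ∉ Finset.univ.image upd →
      bondMat n S i j σ ρ * bondMat n T i j ρ τ = 0 := fun ρ hρ => by
    have h : ¬ agreeOff n i j σ ρ = true := fun h =>
      hρ (Finset.mem_image.2 ⟨(ρ i, ρ j), Finset.mem_univ _, hagree ρ h⟩)
    simp [bondMat_apply, h]
  rw [← Finset.sum_subset (Finset.subset_univ (Finset.univ.image upd)) (fun ρ _ hρ => hzero ρ hρ),
    Finset.sum_image (fun x _ y _ h => hinj h), Fintype.sum_prod_type]
  by_cases hστ : agreeOff n i j σ τ = true
  · rw [if_pos hστ, tabMul]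
    refine Finset.sum_congr rfl fun e _ => Finset.sum_congr rfl fun f _ => ?_
    have h1 : agreeOff n i j σ (upd (e, f)) = true :=
      (agreeOff_eq_true_iff i j _ _).2 fun k hki hkj => (hupd_off _ k hki hkj).symm
    have h2 : agreeOff n i j (upd (e, f)) τ = true :=
      (agreeOff_eq_true_iff i j _ _).2 fun k hki hkj => by
        rw [hupd_off _ k hki hkj]; exact (agreeOff_eq_true_iff i j σ τ).1 hστ k hki hkj
    simp only [bondMat_apply, h1, h2, if_true, hupd_i, hupd_j]
  · rw [if_neg hστ]
    refine Finset.sum_eq_zero fun e _ => Finset.sum_eq_zero fun f _ => ?_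
    have h2 : ¬ agreeOff n i j (upd (e, f)) τ = true := fun h =>
      hστ ((agreeOff_eq_true_iff i j σ τ).2 fun k hki hkj => by
        rw [← hupd_off (e, f) k hki hkj]; exact (agreeOff_eq_true_iff i j _ τ).1 h k hki hkj)
    simp [bondMat_apply, h2]

end Tables

/-! ### Entries of the exchange operator of two distinct sites -/

section Bridge

open Matrix Complex

variable {Λ : Type*} [Fintype Λ] [DecidableEq Λ]

/-- **Two-site matrix elements of `Σ_α S^α ⊗ S^α` for spin `1`**: in the basis `k ↦ m = 1 - k`,
`Σ_α S^α_{ac} S^α_{bd} = Sᶻ_{ac} Sᶻ_{bd} + ½ (S⁺_{ac} S⁻_{bd} + S⁻_{ac} S⁺_{bd})` equals the integer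
table `dTab a b c d` (`⟨k|S⁺|k+1⟩ = √2`, `Sᶻ = diag(1, 0, -1)`). Tasaki (2020) §2.1,
eqs. (2.1.5)–(2.1.6); §2.4, Problem 2.4.a. [folklore] -/
theorem spinOne_pair_entry (a b c d : Fin 3) :
    SpinOperators.spinZ 2 a c * SpinOperators.spinZ 2 b d +
      (1 / 2 : ℂ) * (spinRaise 2 a c * spinLower 2 b d + spinLower 2 a c * spinRaise 2 b d) =
      ((dTab a b c d : ℚ) : ℂ) := by
  have hr : ((Real.sqrt 2 : ℝ) : ℂ) * ((Real.sqrt 2 : ℝ) : ℂ) = 2 := by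
    rw [← Complex.ofReal_mul, Real.mul_self_sqrt zero_le_two]; norm_num
  simp only [spinRaise_two_apply, spinLower_two_apply, spinZ_two_apply, dTab, mQ]
  fin_cases a <;> fin_cases b <;> fin_cases c <;> fin_cases d <;> norm_num [hr]

/-- **Entries of the exchange operator `𝐒_x · 𝐒_y` of two distinct spin-`1` sites**:
`⟨σ|𝐒_x·𝐒_y|τ⟩ = [σ = τ off {x,y}] · dTab (σ x) (σ y) (τ x) (τ y)`. For `x ≠ y` the symmetrised
bond operators are `S^α_x S^α_y` (the factors commute), whose entries are products of single-site
entries (`onSite_mul_onSite_apply_of_ne` of `SpinChainsAkltCorrelationProofs`), summed with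
`spinOne_pair_entry`.
Tasaki (2020) §2.4, eq. (2.4.1) and Problem 2.4.a. [folklore] -/
theorem spinDot_two_apply {x y : Λ} (hxy : x ≠ y) (σ τ : TensorIndex Λ 3) :
    spinDot 2 x y σ τ =
      if (∀ z, z ≠ x → z ≠ y → σ z = τ z) then ((dTab (σ x) (σ y) (τ x) (τ y) : ℚ) : ℂ) else 0 := by
  have hsb : ∀ α, spinBond 2 α x y = siteSpin 2 x α * siteSpin 2 y α := fun α => by
    rw [spinBond, (siteSpin_commute_of_ne_holds 2 hxy α α).eq, ← two_smul ℂ, smul_smul]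
    norm_num
  simp only [spinDot, hsb, Matrix.sum_apply, siteSpin, onSite_mul_onSite_apply_of_ne hxy]
  split_ifs with h
  · rw [sum_spinVec_mul_spinVec]
    exact spinOne_pair_entry (σ x) (σ y) (τ x) (τ y)
  · simp

/-! ### The bond projection on `Fin n` sites is the mapped rational bond matrix -/

/-- On `n` sites labelled by `Fin n`, the exchange operator of two distinct sites is the rational
bond matrix of the table `dTab`, cast to `ℂ`. [folklore] -/
theorem spinDot_eq_map_bondMat {n : ℕ} {i j : Fin n} (hij : i ≠ j) :
    spinDot 2 i j = (bondMat n dTab i j).map ((↑) : ℚ → ℂ) := by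
  ext σ τ
  rw [spinDot_two_apply hij, Matrix.map_apply, bondMat_apply]
  by_cases h : agreeOff n i j σ τ = true
  · rw [if_pos ((agreeOff_eq_true_iff i j σ τ).1 h), if_pos h]
  · rw [if_neg (mt (agreeOff_eq_true_iff i j σ τ).2 h), if_neg h, Rat.cast_zero]

/-- **The AKLT bond projection is the mapped rational bond matrix of `pTab`**: on `Fin n` sites,
`P₂(i, j) = (bondMat n pTab i j).map (ℚ → ℂ)` for `i ≠ j` (from `P₂ = ⅙ D² + ½ D + ⅓`, the
composition rules `bondMat_mul`, `bondMat_one`, and the table identity `pTab_eq`). This is the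
bridge that lets the exact rational certificates speak about `akltProj`. AKLT (1988), eq. (2.1);
Knabe (1988) §3. [folklore] -/
theorem akltProj_eq_map_bondMat {n : ℕ} {i j : Fin n} (hij : i ≠ j) :
    akltProj i j = (bondMat n pTab i j).map ((↑) : ℚ → ℂ) := by
  have hp : pTab = (1 / 6 : ℚ) • tabMul dTab dTab + (1 / 2 : ℚ) • dTab + (1 / 3 : ℚ) • deltaTab := by
    funext a b c d
    simp only [Pi.add_apply, Pi.smul_apply, smul_eq_mul]
    exact pTab_eq a b c d
  rw [hp, bondMat_add, bondMat_add, bondMat_smul, bondMat_smul, bondMat_smul, ← bondMat_mul hij,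
    bondMat_one, akltProj, spinDot_eq_map_bondMat hij]
  ext σ τ
  simp only [Matrix.add_apply, Matrix.smul_apply, Matrix.map_apply, Matrix.mul_apply,
    Matrix.one_apply, smul_eq_mul]
  push_cast
  split_ifs <;> push_cast <;> ring

end Bridge

end Literature.MathematicalPhysics.QuantumLattice
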